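import Mathlib
import Summits.NavierStokesRegularity.NavierStokesRegularity.Theorems.WakeRatchetEternalInviscidRateRetentionCostsAction
import Summits.NavierStokesRegularity.NavierStokesRegularity.Theorems.WakeRatchetEternalInviscidRateLogActionStarvation
import Summits.NavierStokesRegularity.NavierStokesRegularity.Theorems.WakeRatchetTailRatchetDSSAmplitudeFloor
import Summits.NavierStokesRegularity.NavierStokesRegularity.Theses.TaoLadderRungTwoBreak
import HarnessLib

/-!
# K2(1) `TaoLadderRungTwoBreak.BlowupRigidityOne` (stmt-NavierStokesRegularity-20206): the (S₁)-SURVIVING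
  DSS wave the crux must return is LOG-EXPENSIVE — summed profile action `∫ Σ_r‖Φ_r‖ ≥ (Λ/2C_A)·log((1+ε₀)/ε₀)`,
  on `E₂(R)` at least `log((1+ε₀)/ε₀)/128`; the same floor for the action bound of a uniformly bounded surviving
  eternal input

MODEL lattice ODEs only (Tao 2016 §4 (4.8)–(4.10) with the cancellation (4.3), in the self-similar variables of
§6.4; cell vocabulary `IsDSSWave` / `Surviving` / `dssMu` / `IsEternal` / `UniformBound` / `EternalSurvivingFwd`);
nothing in this file is a statement about the Navier–Stokes equations, and NO item is closed by it (`--supports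
stmt-NavierStokesRegularity-20206`).  DEF-FREE.

The WakeRatchet programme landed «retention costs action» (`WakeRatchetDSS.neg_log_one_sub_dssMu_le_action`:
`−log(1 − μ) ≤ 2C_AΛ⁻¹·∫Σ_r‖Φ_r‖` for every non-trivial admissible DSS wave of a cancelling table, `μ = dssMu ε₀ T`
the per-shell energy ratio) and its eternal, non-self-similar form (`FinalWakeLedger.not_survivingFwd_of_action_lt_log`, module `…WakeRatchetEternalInviscidRateLogActionStarvation`).
The survival window of K1(1)/K2(1) is `(1+ε₀)⁻¹ ≤ μ < 1` (`Surviving 1 ε₀ T`), i.e. `1 − μ ≤ ε₀/(1+ε₀)`.  Hence,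
in the currency of items 20206 / 20205 (never cited there before; companion of `…LargeWitnesses`, the `ε₀⁻¹`
AMPLITUDE floor):

* `survivingDSS_neg_log_le_action` — general exponent `a`: an (S_a)-surviving non-trivial admissible DSS wave has
  `−log(1 − (1+ε₀)^{−a}) ≤ 2C_AΛ⁻¹·∫Σ_r‖Φ_r‖`;
* `survivingDSS_log_le_action` — `a = 1`: `log((1+ε₀)/ε₀) ≤ 2C_AΛ⁻¹·∫Σ_r‖Φ_r‖` (general `m`, any profile family);
* `survivingDSS_action_ge` — on an `E₂(R)` table (`m = 4`, `C_A ≤ 64`, `Λ ≥ 1`): `∫Σ_r‖Φ_r‖ ≥ log((1+ε₀)/ε₀)/128`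
  — the L¹ size of the K2(1) witness diverges (logarithmically) as the scale ratio becomes fine, an
  information independent of the amplitude floor `> 1/(896ε₀)` (a bump of that height can have mass `O(1/C_A)`);
* `survivingEternalBdd_log_le_action`, `survivingEternalBdd_action_ge` — the UNIFORMLY BOUNDED slice of the
  classification stub's input: a uniformly bounded forward (S₁)-surviving admissible eternal solution with
  per-shell action bound `M` has `log(1 + 1/ε₀) ≤ 2C_AΛ⁻¹M`, on `E₂(R)` `M ≥ log(1 + 1/ε₀)/128`;
* `blowupRigidityOne_iff_logExpensive` — BY NAME: the route decl `BlowupRigidityOne` is equivalent to the form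
  whose witness additionally satisfies `log((1+ε₀)/ε₀)/128 ≤ ∫Σ_r‖Φ_r‖` (no threshold change needed).

NUMBERS (honest): with `C_A ≤ 64` both floors are weak at moderate ratios — at the rev-1 crossing `ε₀ ≈ 0.0189`
they read amplitude `> 0.059`, action `≥ 0.031` — and bite only as `ε₀ → 0` (`ε₀ = 10⁻⁶`: amplitude `> 1116`,
action `≥ 0.108`; on a table with `C_A = 1` multiply by 64).  HONEST LABEL: bookkeeping over landed theorems of
another route; no stub, crux or summit is proved; rung 0.
-/

noncomputable section

-- the summit and its single sub-problem share the name (CONVENTIONS §1)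
set_option linter.dupNamespace false

namespace Summit.NavierStokesRegularity.NavierStokesRegularity.Theorems

namespace BlowupRigidityOne

open MeasureTheory Set Filter Topology
open Literature.Analysis.FluidPDE Literature.Analysis.FluidPDE.TaoCascade
open Summit.NavierStokesRegularity.NavierStokesRegularity.Theses.TaoLadderRungTwoBreak

section General

variable {ε₀ : ℝ} {m : ℕ} {α : Fin m → Fin m → Fin m → ℤ × ℤ × ℤ → ℝ}
variable {ρ : Type*} [Fintype ρ] {π : Equiv.Perm ρ} {T : ℝ} {Φ : ρ → ℝ → Em m}

/-- **Survival at exponent `a` costs action.**  A non-trivial admissible DSS wave of a cancelling table at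
ratio `1+ε₀` that is (S_a)-surviving (`(1+ε₀)^{-a} ≤ μ < 1`) has summed profile action
`∫Σ_r‖Φ_r‖ ≥ (Λ/2C_A)·(−log(1 − (1+ε₀)^{−a}))`.
[cite: Tao2016AveragedNS, §4 Lemma 4.1 (4.8)–(4.10), (4.3), §6.4; cell theorem] -/
theorem survivingDSS_neg_log_le_action (hε : 0 < ε₀) (hc : IsCancellingCoeff α)
    (hW : IsDSSWave ε₀ α π T Φ) {a : ℝ} (hS : Surviving a ε₀ T) {r : ρ} {x : ℝ} (hne : Φ r x ≠ 0) :
    -Real.log (1 - (1 + ε₀) ^ (-a)) ≤ 2 * fluxConst α * (bigLam ε₀)⁻¹ * ∫ σ, sMass Φ σ := by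
  have h := WakeRatchetDSS.neg_log_one_sub_dssMu_le_action hε hc hW hne
  have hlt : 0 < 1 - dssMu ε₀ T := by linarith [hS.2]
  have hle : 1 - dssMu ε₀ T ≤ 1 - (1 + ε₀) ^ (-a) := by linarith [hS.1]
  have hlog := Real.log_le_log hlt hle
  linarith

/-- **(S₁)-survival costs action `≥ (Λ/2C_A)·log((1+ε₀)/ε₀)`.**  At `a = 1` the survival window gives
`1 − μ ≤ ε₀/(1+ε₀)`, so a non-trivial (S₁)-surviving admissible DSS wave of a cancelling table has
`log((1+ε₀)/ε₀) ≤ 2C_AΛ⁻¹·∫Σ_r‖Φ_r‖`.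
[cite: Tao2016AveragedNS, §4 Lemma 4.1 (4.8)–(4.10), (4.3), §6.4; cell theorem] -/
theorem survivingDSS_log_le_action (hε : 0 < ε₀) (hc : IsCancellingCoeff α)
    (hW : IsDSSWave ε₀ α π T Φ) (hS : Surviving 1 ε₀ T) {r : ρ} {x : ℝ} (hne : Φ r x ≠ 0) :
    Real.log ((1 + ε₀) / ε₀) ≤ 2 * fluxConst α * (bigLam ε₀)⁻¹ * ∫ σ, sMass Φ σ := by
  have h := survivingDSS_neg_log_le_action hε hc hW hS hne
  have h1 : (1 : ℝ) + ε₀ ≠ 0 := by positivity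
  have hrew : 1 - (1 + ε₀) ^ (-(1 : ℝ)) = ε₀ / (1 + ε₀) := by
    rw [Real.rpow_neg (by positivity), Real.rpow_one]
    field_simp
    ring
  have hlog : Real.log ((1 + ε₀) / ε₀) = -Real.log (ε₀ / (1 + ε₀)) := by
    rw [← Real.log_inv, inv_div]
  rw [hlog, ← hrew]
  exact h

end General

section Comparable

variable {ε₀ R : ℝ} {α : Fin 4 → Fin 4 → Fin 4 → ℤ × ℤ × ℤ → ℝ}

/-- On an `E₂(R)` table, `2C_AΛ⁻¹·I ≤ 128·I` for `I ≥ 0` (`C_A ≤ 64`, `Λ ≥ 1`).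
[cite: Tao2016AveragedNS, §4 (4.1), §6.1; cell lemma] -/
theorem two_mul_fluxConst_mul_inv_bigLam_le (hε : 0 < ε₀) (hα : InTableClass R α) {I : ℝ} (hI : 0 ≤ I) :
    2 * fluxConst α * (bigLam ε₀)⁻¹ * I ≤ 128 * I := by
  have hC : fluxConst α ≤ 64 := WakeRatchetDSSAmplitudeFloor.fluxConst_le_64 hα.2.2
  have hC0 : 0 ≤ fluxConst α := fluxConst_nonneg α
  have hΛ : (bigLam ε₀)⁻¹ ≤ 1 := inv_le_one_of_one_le₀ (one_le_bigLam hε.le)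
  have hΛ0 : 0 ≤ (bigLam ε₀)⁻¹ := inv_nonneg.2 (bigLam_pos (by linarith)).le
  have h1 : 2 * fluxConst α * (bigLam ε₀)⁻¹ ≤ 2 * 64 * 1 :=
    mul_le_mul (mul_le_mul_of_nonneg_left hC (by norm_num)) hΛ hΛ0 (by positivity)
  nlinarith

/-- **The uniformly bounded slice of the classification stub's input costs action too.**  A uniformly
bounded, forward (S₁)-surviving admissible eternal solution of a cancelling table with a per-shell action
bound `M` (`∫‖W_k‖ ≤ M` for every shell) has `log(1 + 1/ε₀) ≤ 2C_AΛ⁻¹M` (contrapositive of WakeRatchet's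
`not_survivingFwd_of_action_lt_log`, an `m = 4` theorem). [cite: Tao2016AveragedNS, §4 Lemma 4.1 (4.8)–(4.10), (4.3), §6.4; cell theorem] -/
theorem survivingEternalBdd_log_le_action (hε : 0 < ε₀) (hc : IsCancellingCoeff α) {W : ℤ → ℝ → Em 4}
    (hW : IsEternal ε₀ α W) (hU : UniformBound W) {M : ℝ}
    (hM : ∀ k : ℤ, Integrable (fun σ => ‖W k σ‖) ∧ ∫ σ, ‖W k σ‖ ≤ M) (hs : EternalSurvivingFwd 1 ε₀ W) :
    Real.log (1 + 1 / ε₀) ≤ 2 * fluxConst α * (bigLam ε₀)⁻¹ * M := by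
  by_contra h
  push Not at h
  exact Summit.NavierStokesRegularity.NavierStokesRegularity.Cruxes.EternalInviscidRate.FinalWakeLedger.not_survivingFwd_of_action_lt_log
    hε hc hW hU hM h hs

/-- **The K2(1) witness is log-expensive on `E₂(R)`.**  A non-trivial (S₁)-surviving admissible DSS wave of a
table of `E₂(R)` at ratio `1+ε₀` (any period, shape permutation) has summed profile action
`∫Σ_r‖Φ_r‖ ≥ log((1+ε₀)/ε₀)/128`. [cite: Tao2016AveragedNS, §4 (4.1)–(4.3), Lemma 4.1 (4.8)–(4.10), §6.1, §6.4; cell theorem] -/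
theorem survivingDSS_action_ge (hε : 0 < ε₀) (hα : InTableClass R α)
    {q : ℕ} {π : Equiv.Perm (Fin q)} {T : ℝ} {Φ : Fin q → ℝ → Em 4} (hW : IsDSSWave ε₀ α π T Φ)
    (hS : Surviving 1 ε₀ T) (hne : ∃ r x, Φ r x ≠ 0) :
    Real.log ((1 + ε₀) / ε₀) / 128 ≤ ∫ σ, sMass Φ σ := by
  obtain ⟨r, x, hrx⟩ := hne
  have h := survivingDSS_log_le_action hε hα.2.1 hW hS hrx
  have hI : 0 ≤ ∫ σ, sMass Φ σ := integral_nonneg fun σ => sMass_nonneg Φ σ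
  have h2 := two_mul_fluxConst_mul_inv_bigLam_le hε hα hI
  rw [div_le_iff₀ (by norm_num : (0 : ℝ) < 128)]
  linarith

/-- **The uniformly bounded surviving eternal input is log-expensive on `E₂(R)`**: its per-shell action bound
satisfies `M ≥ log(1 + 1/ε₀)/128`. [cite: Tao2016AveragedNS, §4 (4.1)–(4.3), Lemma 4.1 (4.8)–(4.10), §6.1, §6.4; cell theorem] -/
theorem survivingEternalBdd_action_ge (hε : 0 < ε₀) (hα : InTableClass R α) {W : ℤ → ℝ → Em 4}
    (hW : IsEternal ε₀ α W) (hU : UniformBound W) {M : ℝ}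
    (hM : ∀ k : ℤ, Integrable (fun σ => ‖W k σ‖) ∧ ∫ σ, ‖W k σ‖ ≤ M) (hs : EternalSurvivingFwd 1 ε₀ W) :
    Real.log (1 + 1 / ε₀) / 128 ≤ M := by
  have h := survivingEternalBdd_log_le_action hε hα.2.1 hW hU hM hs
  have hM0 : 0 ≤ M := le_trans (integral_nonneg fun σ => norm_nonneg _) (hM 0).2
  have h2 := two_mul_fluxConst_mul_inv_bigLam_le hε hα hM0
  rw [div_le_iff₀ (by norm_num : (0 : ℝ) < 128)]
  linarith

/-- **BY NAME: the crux is equivalent to its «log-expensive-output» form** — the (S₁)-surviving non-trivial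
admissible DSS wave that `BlowupRigidityOne` asks for automatically has `∫Σ_r‖Φ_r‖ ≥ log((1+ε₀)/ε₀)/128`.
[cite: Tao2016AveragedNS, §4 Thm. 4.2 (statement shape), §6.4; cell theorem] -/
theorem blowupRigidityOne_iff_logExpensive :
    BlowupRigidityOne ↔
      ∀ R : ℝ, 1 ≤ R → ∃ εs : ℝ, 0 < εs ∧ ∀ ε₀ : ℝ, 0 < ε₀ → ε₀ ≤ εs →
        ∀ (α : Fin 4 → Fin 4 → Fin 4 → ℤ × ℤ × ℤ → ℝ) (X₀ : Fin 4 → ℝ),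
          InTableClass R α → NoGlobalCascade ε₀ α X₀ →
            ∃ (q : ℕ) (π : Equiv.Perm (Fin q)) (T : ℝ) (Φ : Fin q → ℝ → Em 4),
              IsDSSWave ε₀ α π T Φ ∧ Surviving 1 ε₀ T ∧ (∃ r x, Φ r x ≠ 0) ∧
                Real.log ((1 + ε₀) / ε₀) / 128 ≤ ∫ σ, sMass Φ σ := by
  constructor
  · intro h R hR
    obtain ⟨εs, hεs, H⟩ := h R hR
    refine ⟨εs, hεs, fun ε₀ hε hle α X₀ hα hNG => ?_⟩
    obtain ⟨q, π, T, Φ, hW, hS, hne⟩ := H ε₀ hε hle α X₀ hα hNG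
    exact ⟨q, π, T, Φ, hW, hS, hne, survivingDSS_action_ge hε hα hW hS hne⟩
  · intro h R hR
    obtain ⟨εs, hεs, H⟩ := h R hR
    refine ⟨εs, hεs, fun ε₀ hε hle α X₀ hα hNG => ?_⟩
    obtain ⟨q, π, T, Φ, hW, hS, hne, -⟩ := H ε₀ hε hle α X₀ hα hNG
    exact ⟨q, π, T, Φ, hW, hS, hne⟩

end Comparable

end BlowupRigidityOne

end Summit.NavierStokesRegularity.NavierStokesRegularity.Theorems

end
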